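import Literature.Analysis.FluidPDE.VorticityCalculus
import Literature.Analysis.FluidPDE.PineauVicolRSSProofs
import Literature.Analysis.FluidPDE.NSSereginDecaySliceTerms
import Summits.NavierStokesRegularity.NavierStokesRegularity.Theorems.RellichScarScarRigidityApexRegularityTimeLemmas
import HarnessLib

/-!
# Route CorkscrewDynamo · crux `CorkscrewProfile` (stmt-NavierStokesRegularity-11282) — integrability of the
# vertical-vorticity flux under Type-I derivative decay (tool stub V3)

Line `registered` (= `Cruxes/CorkscrewProfile/Lines/birth.lean`), lead c6 (2026-08-17), tool stub V3
`stub_verticalVorticityFluxIntegrable` of the STRICT CO-ROTATION block.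

For a rotated Leray profile `U : ℝ³ → ℝ³` write `ω = curl U`, `ω₃ = (curl U ·) 2`, `b = U + ½y − αJy` (`J = rotGen`)
and `F := ω₃ b − ∇ω₃ − U₃ ω` (the vertical-vorticity flux, `½ω₃ = div F`). This file proves the two integrability inputs
of the lead's application of the divergence theorem without boundary (`integral_divergence_eq_zero_of_integrable_div`):

* (a) `integrable_curl_apply_two_of_corotationSphere`: on the co-rotation sphere `|ω|² = 2αω₃` (`α ≠ 0`) with the
  Type-I derivative decay `‖DU(y)‖ ≤ K/(1+‖y‖)²`, `|ω₃| = |ω|²/(2|α|) ≤ ‖curlCLM‖² K² (2|α|)⁻¹ (1+‖y‖)⁻⁴`, which is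
  integrable on `ℝ³` (Mathlib's `integrable_one_add_norm`, `4 > 3 = dim ℝ³`, as packaged by the tree's
  `RellichScarScarRigidity.integrable_inv_one_add_norm_pow_four`); `ω₃` is continuous for `U ∈ C²`
  (`continuous_curl`), and `Integrable.mono'` concludes.
* (b) `integrable_verticalVorticityFlux_div_one_add_norm`: with `‖U‖ ≤ C₀/(1+‖y‖)`, `‖DU‖ ≤ K/(1+‖y‖)²`,
  `‖D curl U‖ ≤ K/(1+‖y‖)³` and `ω₃ ∈ L¹`, the pointwise bound
  `‖F(y)‖/(1+‖y‖) ≤ (C₀ + ½ + |α|)|ω₃(y)| + (K + ‖curlCLM‖ C₀ K)(1+‖y‖)⁻⁴`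
  (`‖Jy‖ ≤ ‖y‖` (`PineauVicol2026.norm_rotGen_le`), `‖∇ω₃‖ = ‖Dω₃‖ ≤ ‖Dω‖` (`norm_gradient_eq_norm_fderiv`),
  `|U₃| ‖ω‖ ≤ C₀ ‖curlCLM‖ K (1+‖y‖)⁻³` (`norm_curl_le`)) gives an integrable majorant, and `F` is continuous for
  `U ∈ C³` (`contDiff_curl`).

All statements are folklore real analysis (domination by an integrable majorant).
-/

noncomputable section

open MeasureTheory Set Function Filter Topology InnerProductSpace
open Literature.Analysis.FluidPDE
open scoped RealInnerProductSpace Laplacian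

namespace Summit.NavierStokesRegularity.NavierStokesRegularity.Theorems.CorkscrewProfile.Birth

set_option linter.dupNamespace false

/-! ### Elementary tools -/

/-- The vertical component `ω₃ = (curl U ·) 2` of the vorticity of a `C¹` field is continuous. [folklore] -/
theorem continuous_curl_apply_two {U : EuclideanSpace ℝ (Fin 3) → EuclideanSpace ℝ (Fin 3)}
    (hU : ContDiff ℝ 1 U) : Continuous fun y => curl U y 2 :=
  (PiLp.continuous_apply 2 (fun _ : Fin 3 => ℝ) 2).comp (continuous_curl hU)

/-- The derivative of the vertical component of a differentiable field is controlled by the derivative of the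
field: `‖D(ω ·)₃(y)‖ ≤ ‖Dω(y)‖` (the coordinate projection has norm at most one). [folklore] -/
theorem norm_fderiv_apply_two_le_norm_fderiv
    {ω : EuclideanSpace ℝ (Fin 3) → EuclideanSpace ℝ (Fin 3)} {y : EuclideanSpace ℝ (Fin 3)}
    (h : DifferentiableAt ℝ ω y) :
    ‖fderiv ℝ (fun w => ω w 2) y‖ ≤ ‖fderiv ℝ ω y‖ := by
  have h2 : HasFDerivAt (fun w => ω w 2) (PiLp.proj 2 (fun _ : Fin 3 => ℝ) 2 ∘L fderiv ℝ ω y) y :=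
    hasFDerivWithinAt_univ.mp
      ((hasFDerivWithinAt_euclidean.mp (hasFDerivWithinAt_univ.mpr h.hasFDerivAt)) 2)
  rw [h2.fderiv]
  refine ContinuousLinearMap.opNorm_le_bound _ (norm_nonneg _) fun v => ?_
  calc ‖(PiLp.proj 2 (fun _ : Fin 3 => ℝ) 2 ∘L fderiv ℝ ω y) v‖ = ‖(fderiv ℝ ω y v) 2‖ := rfl
    _ ≤ ‖fderiv ℝ ω y v‖ := PiLp.norm_apply_le _ 2
    _ ≤ ‖fderiv ℝ ω y‖ * ‖v‖ := ContinuousLinearMap.le_opNorm _ _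

/-! ### (a) The vertical vorticity on the co-rotation sphere is integrable -/

/-- **(a) The vertical vorticity on the co-rotation sphere is integrable.** If `α ≠ 0`, `U ∈ C²`,
`‖DU(y)‖ ≤ K/(1+‖y‖)²` and `|curl U|² = 2α (curl U)₃` everywhere, then `(curl U)₃ ∈ L¹(ℝ³)`:
`|ω₃| = |ω|²/(2|α|) ≤ ‖curlCLM‖² K² (2|α|)⁻¹ (1+‖y‖)⁻⁴`, an integrable majorant of a continuous function. [folklore] -/
theorem integrable_curl_apply_two_of_corotationSphere (α K : ℝ)
    (U : EuclideanSpace ℝ (Fin 3) → EuclideanSpace ℝ (Fin 3)) (hα : α ≠ 0) (hU : ContDiff ℝ 2 U)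
    (hDU : ∀ y : EuclideanSpace ℝ (Fin 3), ‖fderiv ℝ U y‖ ≤ K / (1 + ‖y‖) ^ 2)
    (hS : ∀ y : EuclideanSpace ℝ (Fin 3), ‖curl U y‖ ^ 2 = 2 * α * (curl U y) 2) :
    Integrable (fun y => curl U y 2) := by
  have hcont : Continuous fun y => curl U y 2 := continuous_curl_apply_two (hU.of_le (by norm_num))
  refine (RellichScarScarRigidity.integrable_inv_one_add_norm_pow_four.const_mul
    ((‖curlCLM‖ * K) ^ 2 / (2 * |α|))).mono' hcont.aestronglyMeasurable (ae_of_all _ fun y => ?_)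
  have h1 : curl U y 2 = ‖curl U y‖ ^ 2 / (2 * α) := by
    rw [hS y]; field_simp
  have h2 : ‖curl U y‖ ≤ ‖curlCLM‖ * K / (1 + ‖y‖) ^ 2 := by
    calc ‖curl U y‖ ≤ ‖curlCLM‖ * ‖fderiv ℝ U y‖ := norm_curl_le U y
      _ ≤ ‖curlCLM‖ * (K / (1 + ‖y‖) ^ 2) := by gcongr; exact hDU y
      _ = ‖curlCLM‖ * K / (1 + ‖y‖) ^ 2 := by ring
  have h3 : ‖curl U y‖ ^ 2 ≤ (‖curlCLM‖ * K / (1 + ‖y‖) ^ 2) ^ 2 :=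
    pow_le_pow_left₀ (norm_nonneg _) h2 2
  have hr : (1 + ‖y‖) ≠ 0 := (by positivity : (0 : ℝ) < 1 + ‖y‖).ne'
  have hαa : |α| ≠ 0 := abs_ne_zero.mpr hα
  simp only
  rw [Real.norm_eq_abs, h1, abs_div, abs_pow, abs_norm, abs_mul, abs_two]
  calc ‖curl U y‖ ^ 2 / (2 * |α|) ≤ (‖curlCLM‖ * K / (1 + ‖y‖) ^ 2) ^ 2 / (2 * |α|) :=
        div_le_div_of_nonneg_right h3 (by positivity)
    _ = (‖curlCLM‖ * K) ^ 2 / (2 * |α|) * ((1 + ‖y‖) ^ 4)⁻¹ := by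
        field_simp

/-! ### (b) The weighted vertical-vorticity flux is integrable -/

/-- **(b) The weighted vertical-vorticity flux is integrable.** For `U ∈ C³` with `‖U(y)‖ ≤ C₀/(1+‖y‖)`,
`‖DU(y)‖ ≤ K/(1+‖y‖)²`, `‖D(curl U)(y)‖ ≤ K/(1+‖y‖)³` and `(curl U)₃ ∈ L¹`, the flux
`F = ω₃ (U + ½y − αJy) − ∇ω₃ − U₃ ω` (`ω = curl U`, `ω₃ = (curl U ·) 2`, `J = rotGen`) has
`‖F‖/(1+‖y‖) ∈ L¹(ℝ³)`: `‖F(y)‖/(1+‖y‖) ≤ (C₀ + ½ + |α|)|ω₃(y)| + (K + ‖curlCLM‖ C₀ K)(1+‖y‖)⁻⁴`, an integrable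
majorant of a continuous function. [folklore] -/
theorem integrable_verticalVorticityFlux_div_one_add_norm (α C₀ K : ℝ)
    (U : EuclideanSpace ℝ (Fin 3) → EuclideanSpace ℝ (Fin 3)) (hU : ContDiff ℝ 3 U)
    (hU0 : ∀ y : EuclideanSpace ℝ (Fin 3), ‖U y‖ ≤ C₀ / (1 + ‖y‖))
    (hDU : ∀ y : EuclideanSpace ℝ (Fin 3), ‖fderiv ℝ U y‖ ≤ K / (1 + ‖y‖) ^ 2)
    (hDω : ∀ y : EuclideanSpace ℝ (Fin 3), ‖fderiv ℝ (curl U) y‖ ≤ K / (1 + ‖y‖) ^ 3)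
    (hω3 : Integrable (fun y => curl U y 2)) :
    Integrable (fun y : EuclideanSpace ℝ (Fin 3) =>
      ‖(curl U y 2) • (U y + (1 / 2 : ℝ) • y - α • rotGen y) - gradient (fun w => curl U w 2) y
          - (U y 2) • curl U y‖ / (1 + ‖y‖)) := by
  -- `0 ≤ C₀` (evaluate the hypothesis at the origin)
  have hC₀ : 0 ≤ C₀ := by
    have h := hU0 0
    rw [norm_zero, add_zero, div_one] at h
    exact (norm_nonneg _).trans h
  -- regularity: `curl U ∈ C²`, its vertical component is `C²`, the flux is continuous
  have hω : ContDiff ℝ 2 (curl U) := contDiff_curl (n := 2) (by exact_mod_cast hU)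
  have hω2 : ContDiff ℝ 2 (fun w => curl U w 2) := contDiff_euclidean.mp hω 2
  have hcω : Continuous (curl U) := hω.continuous
  have hcω3 : Continuous fun y => curl U y 2 := hω2.continuous
  have hcg : Continuous (gradient (fun w => curl U w 2)) :=
    (InnerProductSpace.toDual ℝ (EuclideanSpace ℝ (Fin 3))).symm.continuous.comp
      (hω2.continuous_fderiv two_ne_zero)
  have hcU : Continuous U := hU.continuous
  have hcU3 : Continuous fun y => U y 2 := (PiLp.continuous_apply 2 (fun _ : Fin 3 => ℝ) 2).comp hcU
  have hcJ : Continuous (rotGen : EuclideanSpace ℝ (Fin 3) → EuclideanSpace ℝ (Fin 3)) :=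
    rotGenL.continuous.congr rotGenL_apply
  have hc2 : Continuous fun y : EuclideanSpace ℝ (Fin 3) => (1 / 2 : ℝ) • y :=
    continuous_const_smul (1 / 2 : ℝ)
  have hc3 : Continuous fun y : EuclideanSpace ℝ (Fin 3) => α • rotGen y := hcJ.const_smul α
  have hcb : Continuous fun y : EuclideanSpace ℝ (Fin 3) => U y + (1 / 2 : ℝ) • y - α • rotGen y :=
    (hcU.add hc2).sub hc3
  have hG : Continuous fun y : EuclideanSpace ℝ (Fin 3) =>
      (curl U y 2) • (U y + (1 / 2 : ℝ) • y - α • rotGen y) - gradient (fun w => curl U w 2) y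
        - (U y 2) • curl U y :=
    ((hcω3.smul hcb).sub hcg).sub (hcU3.smul hcω)
  have hF : Continuous fun y : EuclideanSpace ℝ (Fin 3) =>
      ‖(curl U y 2) • (U y + (1 / 2 : ℝ) • y - α • rotGen y) - gradient (fun w => curl U w 2) y
          - (U y 2) • curl U y‖ / (1 + ‖y‖) :=
    hG.norm.div (continuous_const.add continuous_norm) fun y => (by positivity : (0 : ℝ) < 1 + ‖y‖).ne'
  -- the integrable majorant `(C₀ + ½ + |α|) |ω₃| + (K + ‖curlCLM‖ C₀ K) (1+‖y‖)⁻⁴`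
  refine ((hω3.norm.const_mul (C₀ + 1 / 2 + |α|)).add
    (RellichScarScarRigidity.integrable_inv_one_add_norm_pow_four.const_mul (K + ‖curlCLM‖ * C₀ * K))).mono'
    hF.aestronglyMeasurable (ae_of_all _ fun y => ?_)
  -- the pointwise bound
  have hr : 0 < 1 + ‖y‖ := by positivity
  have hr1 : 1 ≤ 1 + ‖y‖ := le_add_of_nonneg_right (norm_nonneg _)
  have hyr : ‖y‖ ≤ 1 + ‖y‖ := by linarith [norm_nonneg y]
  simp only
  rw [Real.norm_of_nonneg (by positivity)]
  -- transport term `ω₃ b`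
  have hb : ‖U y + (1 / 2 : ℝ) • y - α • rotGen y‖ ≤ C₀ + (1 / 2 + |α|) * (1 + ‖y‖) := by
    calc ‖U y + (1 / 2 : ℝ) • y - α • rotGen y‖
          ≤ ‖U y‖ + ‖(1 / 2 : ℝ) • y‖ + ‖α • rotGen y‖ := norm_sub_le_of_le (norm_add_le _ _) le_rfl
      _ = ‖U y‖ + 1 / 2 * ‖y‖ + |α| * ‖rotGen y‖ := by
          rw [norm_smul, norm_smul, Real.norm_eq_abs, Real.norm_eq_abs,
            abs_of_pos (by norm_num : (0 : ℝ) < 1 / 2)]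
      _ ≤ C₀ / (1 + ‖y‖) + 1 / 2 * (1 + ‖y‖) + |α| * (1 + ‖y‖) := by
          gcongr
          · exact hU0 y
          · exact (PineauVicol2026.norm_rotGen_le y).trans hyr
      _ ≤ C₀ + (1 / 2 + |α|) * (1 + ‖y‖) := by
          have : C₀ / (1 + ‖y‖) ≤ C₀ := div_le_self hC₀ hr1
          linarith
  have hT1 : ‖(curl U y 2) • (U y + (1 / 2 : ℝ) • y - α • rotGen y)‖
      ≤ |curl U y 2| * (C₀ + (1 / 2 + |α|) * (1 + ‖y‖)) := by
    rw [norm_smul, Real.norm_eq_abs]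
    exact mul_le_mul_of_nonneg_left hb (abs_nonneg _)
  -- diffusion term `∇ω₃`
  have hT2 : ‖gradient (fun w => curl U w 2) y‖ ≤ K / (1 + ‖y‖) ^ 3 := by
    rw [norm_gradient_eq_norm_fderiv]
    exact (norm_fderiv_apply_two_le_norm_fderiv ((hω.differentiable two_ne_zero) y)).trans (hDω y)
  -- stretching term `U₃ ω`
  have hT3 : ‖(U y 2) • curl U y‖ ≤ C₀ / (1 + ‖y‖) * (‖curlCLM‖ * (K / (1 + ‖y‖) ^ 2)) := by
    rw [norm_smul]
    refine mul_le_mul ((PiLp.norm_apply_le (U y) 2).trans (hU0 y)) ?_ (norm_nonneg _) (by positivity)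
    exact (norm_curl_le U y).trans (mul_le_mul_of_nonneg_left (hDU y) (norm_nonneg curlCLM))
  have hFle : ‖(curl U y 2) • (U y + (1 / 2 : ℝ) • y - α • rotGen y) - gradient (fun w => curl U w 2) y
      - (U y 2) • curl U y‖ ≤ |curl U y 2| * (C₀ + (1 / 2 + |α|) * (1 + ‖y‖)) + K / (1 + ‖y‖) ^ 3
        + C₀ / (1 + ‖y‖) * (‖curlCLM‖ * (K / (1 + ‖y‖) ^ 2)) :=
    norm_sub_le_of_le (norm_sub_le_of_le hT1 hT2) hT3
  have hr0 : (1 + ‖y‖) ≠ 0 := hr.ne'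
  calc ‖(curl U y 2) • (U y + (1 / 2 : ℝ) • y - α • rotGen y) - gradient (fun w => curl U w 2) y
          - (U y 2) • curl U y‖ / (1 + ‖y‖)
        ≤ (|curl U y 2| * (C₀ + (1 / 2 + |α|) * (1 + ‖y‖)) + K / (1 + ‖y‖) ^ 3
          + C₀ / (1 + ‖y‖) * (‖curlCLM‖ * (K / (1 + ‖y‖) ^ 2))) / (1 + ‖y‖) :=
      div_le_div_of_nonneg_right hFle hr.le
    _ = |curl U y 2| * C₀ / (1 + ‖y‖) + (1 / 2 + |α|) * |curl U y 2|
          + (K + ‖curlCLM‖ * C₀ * K) * ((1 + ‖y‖) ^ 4)⁻¹ := by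
      field_simp
      ring
    _ ≤ |curl U y 2| * C₀ + (1 / 2 + |α|) * |curl U y 2|
          + (K + ‖curlCLM‖ * C₀ * K) * ((1 + ‖y‖) ^ 4)⁻¹ := by
      gcongr
      exact div_le_self (by positivity) hr1
    _ = (C₀ + 1 / 2 + |α|) * ‖curl U y 2‖ + (K + ‖curlCLM‖ * C₀ * K) * ((1 + ‖y‖) ^ 4)⁻¹ := by
      rw [Real.norm_eq_abs]; ring

/-! ### The registered tool stub V3 -/

/-- **Tool stub V3 `stub_verticalVorticityFluxIntegrable` — integrability under Type-I derivative decay.**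
(a) On the co-rotation sphere `|ω|² = 2αω₃` (`α ≠ 0`) with `‖DU(y)‖ ≤ K/(1+‖y‖)²`:
`|ω₃| = |ω|²/(2|α|) ≤ ‖curlCLM‖² K² (2|α|)⁻¹ (1+‖y‖)⁻⁴` is integrable on `ℝ³`.
(b) With `‖U‖ ≤ C₀/(1+‖y‖)`, `‖DU‖ ≤ K/(1+‖y‖)²`, `‖D curl U‖ ≤ K/(1+‖y‖)³` and `ω₃ ∈ L¹`:
`‖F(y)‖/(1+‖y‖) ≤ (C₀ + ½ + |α|)|ω₃(y)| + (K + ‖curlCLM‖ C₀ K)(1+‖y‖)⁻⁴` for the vertical-vorticity flux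
`F = ω₃ (U + ½y − αJy) − ∇ω₃ − U₃ ω`, an integrable majorant; `F` is continuous for `U ∈ C³`. [folklore] -/
theorem stub_verticalVorticityFluxIntegrable :
    (∀ (α K : ℝ) (U : EuclideanSpace ℝ (Fin 3) → EuclideanSpace ℝ (Fin 3)), α ≠ 0 → ContDiff ℝ 2 U →
      (∀ y : EuclideanSpace ℝ (Fin 3), ‖fderiv ℝ U y‖ ≤ K / (1 + ‖y‖) ^ 2) →
      (∀ y : EuclideanSpace ℝ (Fin 3), ‖curl U y‖ ^ 2 = 2 * α * (curl U y) 2) →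
      MeasureTheory.Integrable (fun y => curl U y 2)) ∧
    (∀ (α C₀ K : ℝ) (U : EuclideanSpace ℝ (Fin 3) → EuclideanSpace ℝ (Fin 3)), ContDiff ℝ 3 U →
      (∀ y : EuclideanSpace ℝ (Fin 3), ‖U y‖ ≤ C₀ / (1 + ‖y‖)) →
      (∀ y : EuclideanSpace ℝ (Fin 3), ‖fderiv ℝ U y‖ ≤ K / (1 + ‖y‖) ^ 2) →
      (∀ y : EuclideanSpace ℝ (Fin 3), ‖fderiv ℝ (curl U) y‖ ≤ K / (1 + ‖y‖) ^ 3) →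
      MeasureTheory.Integrable (fun y => curl U y 2) →
      MeasureTheory.Integrable (fun y : EuclideanSpace ℝ (Fin 3) =>
        ‖(curl U y 2) • (U y + (1 / 2 : ℝ) • y - α • rotGen y) - gradient (fun w => curl U w 2) y
            - (U y 2) • curl U y‖ / (1 + ‖y‖))) :=
  ⟨integrable_curl_apply_two_of_corotationSphere, integrable_verticalVorticityFlux_div_one_add_norm⟩

end Summit.NavierStokesRegularity.NavierStokesRegularity.Theorems.CorkscrewProfile.Birth
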